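import Summits.QuantumFields.BalabanUV.T4Continuum.Support.VariationalVectorEndOfLeaves
import Summits.QuantumFields.BalabanUV.T4Continuum.Support.VariationalAssemblySlice

/-!
# T⁴ programme, spine node NE2 (U1a), lane P2 — THE VECTOR END MODULO THE LEAVES, GAUGE-SLICE VARIANT: the (GF2)-half of the Federbush socket
# replaced by leaf-09-g6's gauge-SLICE (`VariationalAssemblySlice.vector_pair_bracket_sqrt_slice_line`, p220652)
# (`t4/skeletons/NE2-t4-ne2-p2.md` v0.15 §2.E «⟹ V-END»; model level; cell `pub-balaban`)

NE2 formalisation swarm `b2b-balaban-t4-ne2-formalise-*`, leaf prover 10 GEN 3 (`prover-b2b-balaban-t4-ne2-formalise-leaf-10-g3-0`, lineage V-COMP TOWER);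
journal ACK CLAIMS.log 2026-08-20 14:28Z (to leaf-09-g6's design note «V-GF REFRAMED», 14:00Z) and XREAD of p220652 (14:3xZ).  A sibling of
`VariationalVectorEndOfLeaves.towerLimitRate_effV_of_leaves` (p220074) — filed as a separate module so that the landed file stays byte-identical; on top of
p220074's rate lemmas `eV_level_le` ∕ `ePV_level_le` ∕ §2 binders and of p220652's `vector_pair_bracket_sqrt_slice_line` — BY NAME; nothing defined.

THE POINT.  In p220074 the lower bracket takes the Federbush binder `hFED k` for the FULL forms (curl part + gauge functional), i.e. the one-step
consistency (GF2) of `G` — which the tree's located notes (p219068's docstring, N-ne2leaf01g6-1, leaf-09-g6's design note) show is NOT to be expected for a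
divergence-type `G`.  The gauge-slice bracket replaces it, per level `k`, by: the CURL Federbush `hFEDcurl k` against the pure-curl fine form `SfV (R′ k) 0`
(leaf-01's V-FED shape, parameter `δ k`), the SLICE `hslice k` — inside every `Qk`-fibre the set where the coarse form drops to its curl part is reachable at
cost `σ′ k·curl + σ k·size` — and the size contraction of the one-step average (DISCHARGED for contractive line transports `T′ k`).  Along the tower the two
slice costs must DECAY like the other small parameters (`σ k ≤ c_σ·θ^k`, `σ′ k ≤ c_σ′·θ^k`; at `U = 1` Bałaban's `(I − P)∂*` gives `σ = σ′ = 0`,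
leaf-09-g6's reading), and then
  **`towerLimitRate_effV_of_leaves_slice`**: `TowerLimitRate (fun _ ↦ 1) 1 (k ↦ effV (L^k) M (R k) (Gm k) (QmL (L^k) M (T k)) a) C θ`,
  `C = eV Λ⋆ C_P⋆ c_δ + c_σ′·(Λ⋆ + eV Λ⋆ C_P⋆ c_δ) + c_σ·(C_P⋆(Λ⋆+1)) + ePV Λ⋆ C_P⋆ C_R⋆ c_ε c_δ′`,
with the same structural binders as p220074 (`Gm k` PSD, `G k = qform (Gm k) ∘ unc`, COMP DATA identities, one-step `QvL (T′ k)` onto) plus `‖T′ k‖ ≤ 1`.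
The UPPER bracket keeps the `hONE k` socket for the FULL fine form; its supplier of record is leaf-01-g6's file 8 `VariationalVectorOneStepSlice.blockSpin_Q1_le_of_slice`
(p221158), where the fine slice (SLICE′) enters `δ′` as `+ √(σ′_fine·(4(1+d²)+50))` — so the decay binder `δ′ k ≤ c_δ′·θ^k` asks the fine slice cost to decay like `θ^{2k}`.
SOCKETS BY NAME: `hFEDcurl` ← `VariationalVectorFederbushPhys.ScV_QvL_le_curl` (p217269, leaf-01); `hslice` ← V-GF (OPEN: the covariant `P_U` + the curvature
cost of a gauge move); the others as in p220074 (`hUBc`∕`hUBf` ← p218278, `hPc`∕`hPf` ← p219068 + p218347 ∕ p219305, `hONE` ← p219670 at `frameT` carriers with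
the `G′`-half via leaf-01-g6's (SLICE′) file, `hREG` ← V-REG OPEN).

HONEST FRAMING (T4-DAG p. 1).  Model level; transports ∕ forms ∕ functionals DATA (no identification with Bałaban's objects — c5); [folklore] plumbing + real
arithmetic over tree theorems imported BY NAME; nothing printed is a hypothesis; no `def`, no `def … : Prop`, no `sorry`; axioms standard.  (SLICE) and every leaf
DISPLAYED, none discharged here; V-GF OPEN; V-END NOT proved; NE2 NOT proved; spine PROVED 0∕9 unchanged; rung (B)+1 finite T⁴ — NOT infinite volume, NOT mass
gap, NOT Clay.  HONEST DEPENDENCY (cell, verbatim): continuum YM on T⁴ ⇐ BetaPertH ∧ nine spine estimates (0/9 proved); BetaPertH ⇐ (D1) ∧ (D4) ∧ CAP+tail;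
G-an2-4 gates asym, D1 and NE2/3/4.
-/

noncomputable section

namespace Summit.QuantumFields.BalabanUV.T4Continuum.VariationalVectorEndOfLeaves

open Finset
open scoped Matrix ComplexConjugate ComplexOrder Matrix.Norms.L2Operator BigOperators
open Literature.MathematicalPhysics.QuantumFieldTheory.Balaban1983to89.B5Prop11Plancherel (Tor fine unitVec)
open Literature.Analysis.Complex (qform)
open Summit.QuantumFields.BalabanUV.T4Continuum.VariationalTransfer (blockSpin)
open Summit.QuantumFields.BalabanUV.T4Continuum.VariationalColourTower (Rtrv)
open Summit.QuantumFields.BalabanUV.T4Continuum.CovariantAveragingTower (TowerLimitRate)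
open Summit.QuantumFields.BalabanUV.T4Continuum.VectorBlockTrialForm (nsqV nsqV_nonneg QvL compL)
open Summit.QuantumFields.BalabanUV.T4Continuum.VariationalVectorForm
open Summit.QuantumFields.BalabanUV.T4Continuum.VariationalVectorEffective (unc effV)
open Summit.QuantumFields.BalabanUV.T4Continuum.VariationalVectorAverage (continuous_QvL)
open Summit.QuantumFields.BalabanUV.T4Continuum.VariationalVectorTower (Gtr QmL QvL_surjective_of_ub towerLimitRate_effV_of_pairs)
open Summit.QuantumFields.BalabanUV.T4Continuum.VariationalAssemblySlice (vector_pair_bracket_sqrt_slice_line)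

variable {d : ℕ}

/-! ## §1 The per-level rate of the gauge-slice lower defect -/

section Constants

/-- **PER-LEVEL RATE OF THE SLICE LOWER DEFECT**: with `e_F,k := eV (Λ k) (C_P k) (δ k)`, uniform bounds and decay of `δ`, `σ`, `σ′`
(`θ ∈ [0,1]`, everything nonnegative), `e_F,k + σ′_k·(Λ_k + e_F,k) + σ_k·(C_P,k(Λ_k+1)) ≤ (eV Λ⋆ C_P⋆ c_δ + c_σ′·(Λ⋆ + eV Λ⋆ C_P⋆ c_δ) + c_σ·(C_P⋆(Λ⋆+1)))·θ^k`.
[folklore] -/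
theorem eSlice_level_le {Λ Λs CP CPs δ cδ σ cσ σ' cσ' θ : ℝ} (k : ℕ) (hΛ : 0 ≤ Λ) (hΛs : Λ ≤ Λs) (hCP : 0 ≤ CP) (hCPs : CP ≤ CPs)
    (hδ : 0 ≤ δ) (hcδ : 0 ≤ cδ) (hcσ : 0 ≤ cσ) (hcσ' : 0 ≤ cσ') (hθ : 0 ≤ θ) (hθ1 : θ ≤ 1)
    (hδθ : δ ≤ cδ * θ ^ k) (hσθ : σ ≤ cσ * θ ^ k) (hσ'θ : σ' ≤ cσ' * θ ^ k) :
    eV Λ CP δ + σ' * (Λ + eV Λ CP δ) + σ * (CP * (Λ + 1))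
      ≤ (eV Λs CPs cδ + cσ' * (Λs + eV Λs CPs cδ) + cσ * (CPs * (Λs + 1))) * θ ^ k := by
  have ht0 : 0 ≤ θ ^ k := pow_nonneg hθ k
  have ht1 : θ ^ k ≤ 1 := pow_le_one₀ hθ hθ1
  have hE0 : 0 ≤ eV Λs CPs cδ := eV_nonneg (hΛ.trans hΛs) (hCP.trans hCPs) hcδ
  have he0 : 0 ≤ eV Λ CP δ := eV_nonneg hΛ hCP hδ
  have h1 : eV Λ CP δ ≤ eV Λs CPs cδ * θ ^ k := eV_level_le k hΛ hΛs hCP hCPs hδ hθ hθ1 hδθ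
  have h1' : eV Λ CP δ ≤ eV Λs CPs cδ := h1.trans (mul_le_of_le_one_right hE0 ht1)
  have h2 : σ' * (Λ + eV Λ CP δ) ≤ cσ' * θ ^ k * (Λs + eV Λs CPs cδ) :=
    mul_le_mul hσ'θ (add_le_add hΛs h1') (by positivity) (by positivity)
  have h3 : σ * (CP * (Λ + 1)) ≤ cσ * θ ^ k * (CPs * (Λs + 1)) :=
    mul_le_mul hσθ (mul_le_mul hCPs (by linarith) (by linarith) (hCP.trans hCPs)) (by positivity) (by positivity)
  have e : (eV Λs CPs cδ + cσ' * (Λs + eV Λs CPs cδ) + cσ * (CPs * (Λs + 1))) * θ ^ k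
      = eV Λs CPs cδ * θ ^ k + cσ' * θ ^ k * (Λs + eV Λs CPs cδ) + cσ * θ ^ k * (CPs * (Λs + 1)) := by ring
  rw [e]
  linarith

end Constants

/-! ## §2 THE VECTOR END MODULO THE LEAVES, gauge-slice variant -/

section Tower

variable (L : ℕ) [NeZero L] (M : Fin d → ℕ) [hM : ∀ μ, NeZero (M μ)]
variable (R : (k : ℕ) → Tor (fine (L ^ k) M) → Fin d → (ℂ →L[ℂ] ℂ))
variable (R' : (k : ℕ) → Tor (fine L (fine (L ^ k) M)) → Fin d → (ℂ →L[ℂ] ℂ))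
variable (Gm : (k : ℕ) → Matrix (Tor (fine (L ^ k) M) × Fin d) (Tor (fine (L ^ k) M) × Fin d) ℂ)
variable (G : (k : ℕ) → (Tor (fine (L ^ k) M) → Fin d → ℂ) → ℝ)
variable (G' : (k : ℕ) → (Tor (fine L (fine (L ^ k) M)) → Fin d → ℂ) → ℝ)
variable (T : (k : ℕ) → Tor M → (Fin d → Fin (L ^ k)) → Fin (L ^ k) → Fin d → (ℂ →L[ℂ] ℂ))
variable (T' : (k : ℕ) → Tor (fine (L ^ k) M) → (Fin d → Fin L) → Fin L → Fin d → (ℂ →L[ℂ] ℂ))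

/-- **THE VECTOR END OF ROAD P2 MODULO THE LEAVES — GAUGE-SLICE VARIANT.**  As `towerLimitRate_effV_of_leaves` (p220074), but with the Federbush
socket for the FULL forms replaced per level by: the CURL Federbush `hFEDcurl k` against the pure-curl fine form `SfV (R′ k) 0` (parameter `δ k ≤ c_δ·θ^k`),
the gauge-SLICE `hslice k` inside every `QvL (T k)`-fibre (costs `σ′ k ≤ c_σ′·θ^k`, `σ k ≤ c_σ·θ^k`) and contractive one-step line transports `‖T′ k‖ ≤ 1`
(so the size contraction is discharged) — the rest (structural binders, COMP DATA identities, V-UB∕V-P∕V-ONE∕V-REG displayed, uniform level constants,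
`0 ≤ θ < 1`, `0 < a`) VERBATIM.  THEN `TowerLimitRate (fun _ ↦ 1) 1 (k ↦ effV (L^k) M (R k) (Gm k) (QmL (L^k) M (T k)) a) C θ` with
`C = eV Λ⋆ C_P⋆ c_δ + c_σ′·(Λ⋆ + eV Λ⋆ C_P⋆ c_δ) + c_σ·(C_P⋆(Λ⋆+1)) + ePV Λ⋆ C_P⋆ C_R⋆ c_ε c_δ′`.  (SLICE) and every leaf DISPLAYED; nothing of NE3.
[folklore] -/
theorem towerLimitRate_effV_of_leaves_slice (hGm : ∀ k, (Gm k).PosSemidef) (hG : ∀ k W, G k W = qform (Gm k) (unc W))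
    (hTcomp : ∀ k, T (k + 1) = compL (L ^ k) L M (T k) (T' k)) (hRtr : ∀ k, R (k + 1) = Rtrv (L ^ k) L M (R' k))
    (hGtr : ∀ k, G (k + 1) = Gtr (L ^ k) L M (G' k))
    (hT'1 : ∀ k y j t μ, ‖T' k y j t μ‖ ≤ 1) (hsurj₁ : ∀ k, Function.Surjective (QvL L (fine (L ^ k) M) (T' k)))
    {a : ℝ} (ha : 0 < a)
    (Λ CP CR δ ε₁ δ' σ σ' : ℕ → ℝ) {Λs CPs CRs cδ cε cδ' cσ cσ' θ : ℝ}
    (hΛ : ∀ k, 0 ≤ Λ k) (hΛs : ∀ k, Λ k ≤ Λs) (hCP : ∀ k, 0 ≤ CP k) (hCPs : ∀ k, CP k ≤ CPs) (hCR : ∀ k, 0 ≤ CR k) (hCRs : ∀ k, CR k ≤ CRs)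
    (hδ : ∀ k, 0 ≤ δ k) (hε₁ : ∀ k, 0 ≤ ε₁ k) (hδ' : ∀ k, 0 ≤ δ' k) (hσ : ∀ k, 0 ≤ σ k) (hσ' : ∀ k, 0 ≤ σ' k) (hθ : 0 ≤ θ) (hθ1 : θ < 1)
    (hδθ : ∀ k, δ k ≤ cδ * θ ^ k) (hεθ : ∀ k, ε₁ k ≤ cε * θ ^ k) (hδ'θ : ∀ k, δ' k ≤ cδ' * θ ^ k)
    (hσθ : ∀ k, σ k ≤ cσ * θ ^ k) (hσ'θ : ∀ k, σ' k ≤ cσ' * θ ^ k)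
    {ρV : (k : ℕ) → (Tor (fine (L ^ k) M) → Fin d → ℂ) → ℝ} (hρ0 : ∀ k W, 0 ≤ ρV k W)
    -- leaf V-UB at both levels
    (hUBc : ∀ k (φ : Tor M → Fin d → ℂ), ∃ W, QvL (L ^ k) M (T k) W = φ ∧ ScV (L ^ k) M (R k) (G k) W ≤ Λ k * nsqV M φ)
    (hUBf : ∀ k (φ : Tor M → Fin d → ℂ), ∃ W', QvL (L ^ k) M (T k) (QvL L (fine (L ^ k) M) (T' k) W') = φ ∧
      SfV (L ^ k) L M (R' k) (G' k) W' ≤ Λ k * nsqV M φ)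
    -- leaf V-P at both levels
    (hPc : ∀ k W, qWV (L ^ k) M W ≤ CP k * (ScV (L ^ k) M (R k) (G k) W + nsqV M (QvL (L ^ k) M (T k) W)))
    (hPf : ∀ k W', qVV (L ^ k) L M W' ≤ CP k * (SfV (L ^ k) L M (R' k) (G' k) W' + nsqV M (QvL (L ^ k) M (T k) (QvL L (fine (L ^ k) M) (T' k) W'))))
    -- the CURL Federbush against the pure-curl fine form, and the gauge SLICE
    (hFEDcurl : ∀ k W', ScV (L ^ k) M (R k) (fun _ => 0) (QvL L (fine (L ^ k) M) (T' k) W')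
      ≤ (Real.sqrt (SfV (L ^ k) L M (R' k) (fun _ => 0) W') + δ k * Real.sqrt (qVV (L ^ k) L M W')) ^ 2)
    (hslice : ∀ k W, ∃ Ws, QvL (L ^ k) M (T k) Ws = QvL (L ^ k) M (T k) W ∧
      ScV (L ^ k) M (R k) (G k) Ws ≤ ScV (L ^ k) M (R k) (fun _ => 0) W + σ' k * ScV (L ^ k) M (R k) (fun _ => 0) W + σ k * qWV (L ^ k) M W)
    -- leaf V-ONE (square-root shape) and leaf V-REG
    (hONE : ∀ k W, blockSpin (QvL L (fine (L ^ k) M) (T' k)) (SfV (L ^ k) L M (R' k) (G' k)) W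
      ≤ (Real.sqrt (ScV (L ^ k) M (R k) (G k) W + ε₁ k * ρV k W) + δ' k * Real.sqrt (qWV (L ^ k) M W)) ^ 2)
    (hREG : ∀ k (φ : Tor M → Fin d → ℂ) W, QvL (L ^ k) M (T k) W = φ →
      (∀ W₂, QvL (L ^ k) M (T k) W₂ = φ → ScV (L ^ k) M (R k) (G k) W ≤ ScV (L ^ k) M (R k) (G k) W₂) →
      ρV k W ≤ CR k * (ScV (L ^ k) M (R k) (G k) W + nsqV M φ)) :
    TowerLimitRate (ι := fun _ => Tor M × Fin d) (fun _ => (1 : Matrix (Tor M × Fin d) (Tor M × Fin d) ℂ)) 1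
      (fun k => effV (L ^ k) M (R k) (Gm k) (QmL (L ^ k) M (T k)) a)
      (eV Λs CPs cδ + cσ' * (Λs + eV Λs CPs cδ) + cσ * (CPs * (Λs + 1)) + ePV Λs CPs CRs cε cδ') θ := by
  -- (GF0) and continuity at every level, from the matrix form and one step up through `Gtr`
  have hG0 : ∀ k W, 0 ≤ G k W := fun k => nonneg_of_qform (L ^ k) M (hGm k) (hG k)
  have hGc : ∀ k, Continuous (G k) := fun k => continuous_of_qform (L ^ k) M (hG k)
  have hG0' : ∀ k W', 0 ≤ G' k W' := fun k => nonneg_of_Gtr (L ^ k) L M (hGtr k) (hG0 (k + 1))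
  have hGc' : ∀ k, Continuous (G' k) := fun k => continuous_of_Gtr (L ^ k) L M (hGtr k) (hGc (k + 1))
  -- the starred constants are nonnegative (level 0)
  have hθ1' : θ ≤ 1 := hθ1.le
  have hΛs0 : 0 ≤ Λs := (hΛ 0).trans (hΛs 0)
  have hCPs0 : 0 ≤ CPs := (hCP 0).trans (hCPs 0)
  have hCRs0 : 0 ≤ CRs := (hCR 0).trans (hCRs 0)
  have hcδ : 0 ≤ cδ := by have := (hδ 0).trans (hδθ 0); simpa using this
  have hcε : 0 ≤ cε := by have := (hε₁ 0).trans (hεθ 0); simpa using this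
  have hcδ' : 0 ≤ cδ' := by have := (hδ' 0).trans (hδ'θ 0); simpa using this
  have hcσ : 0 ≤ cσ := by have := (hσ 0).trans (hσθ 0); simpa using this
  have hcσ' : 0 ≤ cσ' := by have := (hσ' 0).trans (hσ'θ 0); simpa using this
  have hE0 : 0 ≤ eV Λs CPs cδ := eV_nonneg hΛs0 hCPs0 hcδ
  have hEP0 : 0 ≤ ePV Λs CPs CRs cε cδ' := ePV_nonneg hΛs0 hCPs0 hCRs0 hcε hcδ'
  have hS0 : 0 ≤ eV Λs CPs cδ + cσ' * (Λs + eV Λs CPs cδ) + cσ * (CPs * (Λs + 1)) := by positivity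
  have hC : 0 ≤ eV Λs CPs cδ + cσ' * (Λs + eV Λs CPs cδ) + cσ * (CPs * (Λs + 1)) + ePV Λs CPs CRs cε cδ' := add_nonneg hS0 hEP0
  -- per-level rates of the two defects
  have he : ∀ k, eV (Λ k) (CP k) (δ k) + σ' k * (Λ k + eV (Λ k) (CP k) (δ k)) + σ k * (CP k * (Λ k + 1))
      ≤ (eV Λs CPs cδ + cσ' * (Λs + eV Λs CPs cδ) + cσ * (CPs * (Λs + 1)) + ePV Λs CPs CRs cε cδ') * θ ^ k := fun k => by
    have h1 := eSlice_level_le k (hΛ k) (hΛs k) (hCP k) (hCPs k) (hδ k) hcδ hcσ hcσ' hθ hθ1' (hδθ k) (hσθ k) (hσ'θ k)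
    have h2 : 0 ≤ ePV Λs CPs CRs cε cδ' * θ ^ k := mul_nonneg hEP0 (pow_nonneg hθ k)
    linarith [add_mul (eV Λs CPs cδ + cσ' * (Λs + eV Λs CPs cδ) + cσ * (CPs * (Λs + 1))) (ePV Λs CPs CRs cε cδ') (θ ^ k)]
  have he' : ∀ k, ePV (Λ k) (CP k) (CR k) (ε₁ k) (δ' k)
      ≤ (eV Λs CPs cδ + cσ' * (Λs + eV Λs CPs cδ) + cσ * (CPs * (Λs + 1)) + ePV Λs CPs CRs cε cδ') * θ ^ k := fun k => by
    have h1 := ePV_level_le k (hΛ k) (hΛs k) (hCP k) (hCPs k) (hCR k) (hCRs k) (hε₁ k) hcε (hδ' k) hcδ' hθ hθ1' (hεθ k) (hδ'θ k)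
    have h2 : 0 ≤ (eV Λs CPs cδ + cσ' * (Λs + eV Λs CPs cδ) + cσ * (CPs * (Λs + 1))) * θ ^ k := mul_nonneg hS0 (pow_nonneg hθ k)
    linarith [add_mul (eV Λs CPs cδ + cσ' * (Λs + eV Λs CPs cδ) + cσ * (CPs * (Λs + 1))) (ePV Λs CPs CRs cε cδ') (θ ^ k)]
  -- the gauge-slice brackets, level by level, fed to the pair-to-rate currency
  exact towerLimitRate_effV_of_pairs L M R R' Gm G G' T T' hGm hG (fun k => QvL_surjective_of_ub (L ^ k) M (hUBc k)) hPc hTcomp hRtr hGtr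
    ha hC hθ hθ1 (fun k => eV (Λ k) (CP k) (δ k) + σ' k * (Λ k + eV (Λ k) (CP k) (δ k)) + σ k * (CP k * (Λ k + 1)))
    (fun k => ePV (Λ k) (CP k) (CR k) (ε₁ k) (δ' k)) he he'
    fun k φ => vector_pair_bracket_sqrt_slice_line (L ^ k) L M (continuous_QvL (L ^ k) M (T k)) (hT'1 k) (hsurj₁ k) (hG0 k) (hGc k) (hG0' k)
      (hGc' k) (hΛ k) (hCP k) (hCR k) (hδ k) (hε₁ k) (hδ' k) (hσ k) (hσ' k) (hρ0 k) (hUBc k) (hUBf k) (hPc k) (hPf k) (hFEDcurl k)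
      (hslice k) (hONE k) (hREG k) φ

end Tower

end Summit.QuantumFields.BalabanUV.T4Continuum.VariationalVectorEndOfLeaves

end
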